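import Literature.MathematicalPhysics.QuantumLattice.FinDimSpectrum
import Literature.MathematicalPhysics.QuantumLattice.LatticeTori
import Literature.MathematicalPhysics.QuantumLattice.FermionOperators
import Literature.MathematicalPhysics.QuantumLattice.HubbardModel
import Literature.MathematicalPhysics.QuantumLattice.PairCorrelations
import Literature.Analysis.FunctionSpaces.LiebWuIntegrals
import Literature.Probability.LatticeModels.ThermodynamicLimit
import Literature.Probability.LatticeModels.CorrelationDecay
import HarnessLib

-- D-0014 sorry-sweep (operator, 2026-08-13): sorried theorems -> named facts `def X : Prop`; partial proofs preserved in comments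
-- provenance: harness21/H21/H21/Statements/Hubbard/HubbardModel.lean @ 1052202 (interim HEAD d8f2665); M5 mechanical rewrite
/-!
# Hubbard family — target statements on the Hubbard model

Family `hubbard` (trunk T-QLATTICE), statement item G13 `HubbardStatements` of the architect's
outline `H21/Outlines/QLatticeAQFT.md` §3. Everything model-theoretic (Fock space, CAR, the
Hubbard Hamiltonian `Literature.MathematicalPhysics.QuantumLattice.hamiltonian`, `hubbardTorus`, `hubbardTorusWith`, `torusStagger`,
`etaPairingState`, `groundEnergyAt`, `chargeGap`, `energyPerSite`, `IsGroundStateInSector`,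
`pairAmplitude`, `dWaveFormFactor`, `HasPairFieldLRO`, `HasTorusLRO`, `torusDist`,
`Matrix.thermalCorr`, `liebWuEnergy`, `liebWuChargeGap`) is imported from the accepted prelude and
wave-0 files; this file only combines them into the four target statements.

## Covered statement ids

* **hubbard.S01** `DWaveSuperconductivityHubbard` — `d_{x²-y²}` superconducting long-range order
  in the ground state of the doped two-dimensional repulsive Hubbard model (OPEN PROBLEM, stated
  as `def … : Prop`, not asserted). Scalapino, Phys. Rep. 250 (1995) 329; Arovas–Berg–Kivelson–
  Raghu, Ann. Rev. CMP 13 (2022) 239; Qin et al., PRX 10 (2020) 031016.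
* **hubbard.S08** `yang_etaPairing_eigenvector`, `yang_etaPairing_pairAmplitude`,
  `yang_etaPairing_hasODLRO` — Yang's `η`-pairing eigenstates and their ODLRO.
  Yang, PRL 63 (1989) 2144, eqs. (7)–(11).
* **hubbard.S10** `lieb_wu`, `lieb_wu_mott_insulator` — the Lieb–Wu ground-state energy and
  charge gap of the half-filled Hubbard chain (Bethe ansatz closed forms from
  `Literature.Prelude.Sobolev.LiebWuIntegrals`). Lieb–Wu, PRL 20 (1968) 1445; Physica A 321 (2003) 1.
* **hubbard.S11** `koma_tasaki_2d`, `koma_tasaki_1d`, `koma_tasaki_magnetic`,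
  `koma_tasaki_noLRO` — decay of superconducting and magnetic correlations of the Hubbard Gibbs
  state in `d ≤ 2`. Koma–Tasaki, PRL 68 (1992) 3248.

## Mathlib search

`rg -i 'hubbard|eta.pairing|Lieb.Wu|Koma|ODLRO'` over Mathlib finds nothing; all notions come from
the H21 prelude. Mathlib supplies `Filter.Tendsto`, `Filter.liminf`, `Set.Ioo`, `Nat.floor`
(`⌊·⌋₊`), `Real.rpow`, `Real.exp`, `Matrix.mulVec`, `dotProduct`.

## Design notes

* Long-range order always goes through the outline-§0 convention `QLattice.HasTorusLRO` (G02's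
  `StatMech.HasLongRangeOrder` over `halfOpenBox d L`, normalisation `L^{-2d}`); for `d = 2` this
  is exactly the `|Λ_L|⁻² = L⁻⁴` of the hubbard.S01 text (review F1).
* hubbard.S01 fixes the hopping `t = 1` (the text's normalisation; review F12b). The hypothesis
  includes the normalisation `⟨ψ_L, ψ_L⟩ = 1`, because `HasPairFieldLRO` demands unit vectors and
  `IsGroundStateInSector` only demands `ψ ≠ 0`; without it the statement would be trivially false
  by rescaling a ground state.
* hubbard.S08 is indexed by the number `m` of `η`-pairs (`N = 2m`), following the prelude's
  `etaPairingState ε m`; Yang's constant pair amplitude is transcribed from PRL 63 (1989) eq. (10)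
  as `ε_x ε_y · m (M - m) / (M (M - 1))`, `M = |Λ| = L²`, in the division-free form
  `pairAmplitude x y ψ = value · ⟨ψ, ψ⟩`. The ODLRO corollary is stated for normalised multiples of
  the `η`-states with `m_L → ∞` and pair density bounded away from complete filling,
  `m_L ≤ (1 - δ) L²` (the hypothesis under which Yang's eigenvalue `λ = 2m(M - m + 1)/M` of `ρ₂`
  is `≥ 2δ · m`, as wave-0 `HasODLRO` requires).
* hubbard.S10: the chain of `L` sites with periodic boundary conditions is
  `hubbardChain L = fermionTorusGraph 1 L`; limits are taken along even `L = 2n` (Lieb–Wu work at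
  half filling `N = L` with `N` even; the limit along all `L` is expected to coincide but is not
  what the cited papers state). At `n = 0` the terms are junk values, irrelevant along `atTop`.
* hubbard.S11: the chemical potential `μ` is a universally quantified argument ("any filling",
  review F12a). The `d = 2` bound is `C · (dist(x,y) + 1)^{-f}` with the periodic `ℓ^∞` distance
  `torusDist`; the constant `C` absorbs Koma–Tasaki's short-distance threshold. The thermal
  two-point functions as `L`-indexed families (`thermalPairCorr`, `thermalSpinCorr`) carry the
  junk value `0` at `L = 0` (`FermionTorus.ofTorusSite` needs `L ≠ 0`), like `pairFieldCorr`.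
-/

noncomputable section

namespace Literature.MathematicalPhysics.QuantumLattice

open Matrix Finset Filter Literature.Probability.LatticeModels
open scoped ComplexOrder Topology

/-! ### hubbard.S01: `d`-wave superconductivity in the 2D Hubbard model (open problem) -/

/-! ### hubbard.S08: Yang's `η`-pairing states -/

section EtaPairing

variable {L : ℕ}

/-- **hubbard.S08** (Yang's `η`-pairing eigenstates). On the torus `(ℤ/Lℤ)²` of even side (so
that `ε_x = e^{iπ·x} = torusStagger x` is a bipartite sign), for every hopping `t`, EVERY
interaction `U` and every `m ≤ |Λ| = L²`, the state `(η†)^m |0⟩`,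
`η† = Σ_x ε_x c†_{x↑} c†_{x↓}`, is a nonzero exact eigenvector of the Hubbard Hamiltonian, with
eigenvalue `m U` (`2m = N` electrons). It is not a ground state for `U > 0`.
Yang, PRL 63 (1989) 2144, eqs. (7)–(8). [cite: Yang1989, eqs. (7)–(8)] -/
def yang_etaPairing_eigenvector : Prop :=
  ∀ (hL : Even L) (t U : ℝ) (m : ℕ) (hm : m ≤ L ^ 2),
    etaPairingState (torusStagger (d := 2) (L := L)) m ≠ 0 ∧
      hubbardTorus 2 L t U *ᵥ etaPairingState torusStagger m =
        ((m * U : ℝ) : ℂ) • etaPairingState torusStagger m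

/-- Yang's value of the off-diagonal pair amplitude of `(η†)^m |0⟩` on `M` sites:
`m (M - m) / (M (M - 1))` (the ratio `C(M-2, m-1) / C(M, m)` of the numbers of pair
configurations). With `m = N/2` this is `(N/2)(M - N/2)/(M(M-1)) ≈ (ρ/2)(1 - ρ/2)`, `ρ = N/M`.
Junk value by `x / 0 = 0` for `M ≤ 1`. Yang, PRL 63 (1989) 2144, eq. (10).
[cite: Yang1989, eq. (10)] -/
def yangPairAmplitude (M m : ℕ) : ℝ := m * (M - m : ℝ) / (M * (M - 1 : ℝ))

/-- **hubbard.S08** (constant off-diagonal pair amplitude). For Yang's state `ψ = (η†)^m |0⟩` on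
the torus `(ℤ/Lℤ)²` (`M = L²` sites) and any two distinct sites `x ≠ y`,
`⟨ψ, c†_{x↑} c†_{x↓} c_{y↓} c_{y↑} ψ⟩ = ε_x ε_y · m (M - m)/(M (M - 1)) · ⟨ψ, ψ⟩`: up to the
stagger sign `ε_x ε_y = ±1` the pair amplitude is independent of `x ≠ y` and of order
`(N/|Λ|)(1 - N/|Λ|)`. (Division-free form; both sides vanish for `m > M`.)
Yang, PRL 63 (1989) 2144, eqs. (9)–(10). [cite: Yang1989, eqs. (9)–(10)] -/
def yang_etaPairing_pairAmplitude : Prop :=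
  ∀ (m : ℕ) (x y : FermionTorus 2 L) (hxy : x ≠ y),
    pairAmplitude x y (etaPairingState torusStagger m) =
      (((torusStagger x : ℤ) * (torusStagger y : ℤ) * yangPairAmplitude (L ^ 2) m : ℝ) : ℂ) *
        (star (etaPairingState (torusStagger (d := 2) (L := L)) m) ⬝ᵥ
          etaPairingState torusStagger m)

/-- **hubbard.S08** (ODLRO of the `η`-pairing states). Let `ψ L` be normalised multiples of the
`η`-pairing states `(η†)^{m_L} |0⟩` on the tori `(ℤ/Lℤ)²` with `m_L → ∞` pairs and pair density
bounded away from complete filling, `m_L ≤ (1 - δ) L²`. Then the family has off-diagonal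
long-range order in Yang's sense (wave-0 `HasODLRO` with `N_L = 2 m_L`): the pair wavefunction
`v = M^{-1/2} Σ_x ε_x |x↑, x↓⟩` has `⟨v, ρ₂ v⟩ = 2 m_L (M - m_L + 1)/M ≥ 2δ m_L`.
Yang, PRL 63 (1989) 2144, eq. (11); Yang, Rev. Mod. Phys. 34 (1962) 694, §4.
[cite: Yang1989, eq. (11)] [cite: YangODLRO1962, §4] -/
def yang_etaPairing_hasODLRO : Prop :=
  ∀ (m : ℕ → ℕ) (ψ : ∀ L, Fock (Orb (FermionTorus 2 L)))
    (hψ : ∀ L, ∃ a : ℂ, ψ L = a • etaPairingState torusStagger (m L))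
    (hnorm : ∀ L, star (ψ L) ⬝ᵥ ψ L = 1) (hm : Tendsto m atTop atTop)
    (hδ : ∃ δ : ℝ, 0 < δ ∧ ∀ᶠ L : ℕ in atTop, (m L : ℝ) ≤ (1 - δ) * (L : ℝ) ^ 2),
    HasODLRO (fun L => 2 * m L) ψ

end EtaPairing

/-! ### hubbard.S10: Lieb–Wu -/

/-- The Hubbard chain of `L` sites with periodic boundary conditions: the nearest-neighbour graph
of the one-dimensional fermionic torus `ℤ/Lℤ` (`fermionTorusGraph 1 L`; for `L = 2` the two
"bonds" of the ring coincide, for `L ≤ 1` there are none). An `abbrev`, so that the prelude's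
`DecidableRel` instance is found. Lieb–Wu, PRL 20 (1968) 1445. [cite: LiebWuPRL1968, eq. (1)] -/
abbrev hubbardChain (L : ℕ) : SimpleGraph (FermionTorus 1 L) := fermionTorusGraph 1 L

/-- **hubbard.S10** (Lieb–Wu). For the Hubbard chain with hopping `t = 1` and interaction `U > 0`
at half filling `N = L`, along rings of even length `L = 2n → ∞`:
(i) the ground-state energy per site converges to
`e(U) = -4 ∫₀^∞ J₀(ω) J₁(ω) / (ω (1 + e^{ωU/2})) dω` (`Hubbard.liebWuEnergy U`), and
(ii) the charge gap `μ₊ - μ₋ = E(N+1) + E(N-1) - 2E(N)` converges to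
`U - 4 + 8 ∫₀^∞ J₁(ω) / (ω (1 + e^{ωU/2})) dω` (`Hubbard.liebWuChargeGap U`), which is `> 0`
(`Hubbard.liebWuChargeGap_pos`, `lieb_wu_mott_insulator`). The restriction to even `L` follows
Lieb–Wu (half filling with `N` even). Lieb–Wu, PRL 20 (1968) 1445, eqs. (20)–(23) ((20): the
energy `E(N_a/2, N_a/2; U)`; (21): `μ_±` as differences of sector ground-state energies; (22):
`μ₊ = U - μ₋`; (23): `μ₋`); Lieb–Wu, Physica A 321 (2003) 1, §6 (boxed `ρ₀`, `σ₀`, `E₀`) and §7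
(boxed `μ₋`).
RIGOUR STATUS (recorded 2026-08-15; details in the module docstring of `LiebWuBetheAnsatz.lean`,
"Rigour status of the nodes"). `LiebWuBetheAnsatz.lean` decomposes this fact along the printed
Bethe-ansatz derivation into the named facts F1 (Goldbaum's existence theorem), F2c (on the ring
of `4m + 2 ≥ 6` sites the Bethe state is the ground state of its sector), F3 (thermodynamic limit
of the Bethe energies), F4 (existence of the limit along even rings), F5a (particle–hole symmetry)
and F5b (`E(2n) - E(2n-1) → μ₋(U)`), with the assembly proved. F1, F3, F4, F5a and the nested
Bethe-ansatz eigenvector theorem (Lieb–Wu 1968, eqs. (3)–(11); `LiebWuBetheEigenvector.lean`) are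
PROVED in the tree, so that part (i) rests on F2c alone and part (ii) on F5b alone
(`LiebWuRootDensityIdentification.lean`, epilogue). Neither F2c nor F5b has a complete proof in
print: Lieb–Wu 2003, §2, on the identification of the Bethe state with the ground state — "we
are unable to carry it out and we leave it as an open problem" (Goldbaum 2005, §4 and §6, argues
by continuity from `U = ∞`, where the lowest level of the half-filled sector is degenerate);
Lieb–Wu 2003, §7, derives `μ₋(U)` to leading order only. The statement below therefore
transcribes the announced and universally accepted result AS PRINTED (not weakened); it is not,
as it stands, a theorem with a complete published proof. [cite: LiebWuPRL1968, eqs. (20)–(23)]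
[cite: LiebWuPhysicaA2003, §6 and §7 (boxed formulas)] [cite: Goldbaum2005, Thm 1.1, §§4–5] -/
def lieb_wu : Prop :=
  ∀ (U : ℝ) (hU : 0 < U),
    Tendsto (fun n : ℕ => energyPerSite (hubbardChain (2 * n)) 1 U (2 * n)) atTop
        (𝓝 (Literature.Analysis.FunctionSpaces.liebWuEnergy U)) ∧
      Tendsto (fun n : ℕ => chargeGap (hubbardChain (2 * n)) 1 U (2 * n)) atTop
        (𝓝 (Literature.Analysis.FunctionSpaces.liebWuChargeGap U))

/-- **hubbard.S10** (Mott insulator, no Mott transition at `U > 0`). For every `U > 0` the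
Lieb–Wu charge gap is strictly positive (re-export of `Hubbard.liebWuChargeGap_pos`), and
consequently the finite-volume charge gaps of the half-filled chains of even length are
eventually bounded below by half of it. Lieb–Wu, PRL 20 (1968) 1445, discussion after eq. (23)
("`μ₊ > μ₋` for `U > 0` … there is no Mott transition for nonzero `U`"); Lieb–Wu, Physica A 321
(2003) 1, §7. The first conjunct is PROVED (`liebWuChargeGap_pos_holds`,
`LiebWuChargeGapProofs.lean`); the second rests on part (ii) of `lieb_wu`, i.e. on F5b (see the
rigour status in the docstring of `lieb_wu`; reductions in `HubbardHubbardModelMottProofs.lean`).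
[cite: LiebWuPRL1968, discussion after eq. (23)] [cite: LiebWuPhysicaA2003, §7] -/
def lieb_wu_mott_insulator : Prop :=
  ∀ (U : ℝ) (hU : 0 < U),
    0 < Literature.Analysis.FunctionSpaces.liebWuChargeGap U ∧
      ∀ᶠ n : ℕ in atTop, Literature.Analysis.FunctionSpaces.liebWuChargeGap U / 2 < chargeGap (hubbardChain (2 * n)) 1 U (2 * n)

/- interim proof relied on results that are now named facts (D-0014); demoted to a fact by the
D-0014 sorry-sweep, proof preserved:
:= by
  refine ⟨liebWuChargeGap_pos hU, ?_⟩
  have h : liebWuChargeGap U / 2 < liebWuChargeGap U := by linarith [liebWuChargeGap_pos hU]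
  exact (lieb_wu U hU).2.eventually (eventually_gt_nhds h)
-/

/-- Conditional discharge of `lieb_wu_mott_insulator` from the named facts `lieb_wu` and
`Hubbard.liebWuChargeGap_pos`. [cite: LiebWuPRL1968, discussion after eq. (22)] -/
theorem lieb_wu_mott_insulator_of (hLW : lieb_wu) (hpos : Literature.Analysis.FunctionSpaces.liebWuChargeGap_pos) :
    lieb_wu_mott_insulator := by
  intro U hU
  refine ⟨hpos hU, ?_⟩
  have h : Literature.Analysis.FunctionSpaces.liebWuChargeGap U / 2 < Literature.Analysis.FunctionSpaces.liebWuChargeGap U := by linarith [hpos hU]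
  exact (hLW U hU).2.eventually (eventually_gt_nhds h)

/-! ### hubbard.S11: Koma–Tasaki -/

section KomaTasaki

variable {d L : ℕ}

/-- The on-site pair annihilation operator `c_{x↓} c_{x↑}` at the torus site `x ∈ (ℤ/Lℤ)^d`
(orbitals on the fermionic torus via `FermionTorus.ofTorusSite`); its adjoint is
`c†_{x↑} c†_{x↓}`, so `⟨(pair x)ᴴ pair y⟩ = ⟨c†_{x↑} c†_{x↓} c_{y↓} c_{y↑}⟩` is the superconducting
correlation of Koma–Tasaki. Koma–Tasaki, PRL 68 (1992) 3248, eq. (2).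
[cite: KomaTasakiPRL1992, eq. (2)] -/
def onSitePair [NeZero L] (x : TorusSite d L) :
    Matrix (Finset (Orb (FermionTorus d L))) (Finset (Orb (FermionTorus d L))) ℂ :=
  annihilation (orb (FermionTorus.ofTorusSite x) 1) *
    annihilation (orb (FermionTorus.ofTorusSite x) 0)

/-- The local spin-raising operator `S⁺_x = c†_{x↑} c_{x↓}` at the torus site `x`; its adjoint is
`S⁻_x = c†_{x↓} c_{x↑}`, so `⟨S⁺_x (S⁺_y)ᴴ⟩ = ⟨S⁺_x S⁻_y⟩` is the (transverse) magnetic correlation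
of Koma–Tasaki. Koma–Tasaki, PRL 68 (1992) 3248, eq. (3). [cite: KomaTasakiPRL1992, eq. (3)] -/
def siteSpinPlus [NeZero L] (x : TorusSite d L) :
    Matrix (Finset (Orb (FermionTorus d L))) (Finset (Orb (FermionTorus d L))) ℂ :=
  creation (orb (FermionTorus.ofTorusSite x) 0) *
    annihilation (orb (FermionTorus.ofTorusSite x) 1)

/-- The adjoint of the on-site pair operator is `c†_{x↑} c†_{x↓}`.
Koma–Tasaki, PRL 68 (1992) 3248, eq. (2). [folklore] -/
theorem onSitePair_conjTranspose [NeZero L] (x : TorusSite d L) :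
    (onSitePair x)ᴴ =
      creation (orb (FermionTorus.ofTorusSite x) 0) *
        creation (orb (FermionTorus.ofTorusSite x) 1) := by
  simp [onSitePair, conjTranspose_mul, annihilation_conjTranspose]

/-- The thermal superconducting two-point function of the grand-canonical Hubbard model on the
torus `(ℤ/Lℤ)^d`, `G_L(x, y) = re ⟨c†_{x↑} c†_{x↓} c_{y↓} c_{y↑}⟩_{β, L}` (Gibbs state
`Matrix.gibbsState β (hubbardTorusWith d L t U μ)`), as an `L`-indexed family in the format of
`QLattice.HasTorusLRO`. **Junk value** `0` at `L = 0`. Koma–Tasaki, PRL 68 (1992) 3248, eq. (2).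
[cite: KomaTasakiPRL1992, eq. (2)] -/
def thermalPairCorr (β t U μ : ℝ) : (L : ℕ) → TorusSite d L → TorusSite d L → ℝ
  | 0, _, _ => 0
  | L + 1, x, y =>
    ((hubbardTorusWith d (L + 1) t U μ).thermalCorr β (onSitePair x)ᴴ (onSitePair y)).re

/-- The thermal transverse magnetic two-point function `re ⟨S⁺_x S⁻_y⟩_{β, L}` of the
grand-canonical Hubbard model on `(ℤ/Lℤ)^d`, as an `L`-indexed family. **Junk value** `0` at
`L = 0`. Koma–Tasaki, PRL 68 (1992) 3248, eq. (3). [cite: KomaTasakiPRL1992, eq. (3)] -/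
def thermalSpinCorr (β t U μ : ℝ) : (L : ℕ) → TorusSite d L → TorusSite d L → ℝ
  | 0, _, _ => 0
  | L + 1, x, y =>
    ((hubbardTorusWith d (L + 1) t U μ).thermalCorr β (siteSpinPlus x) (siteSpinPlus y)ᴴ).re

/-- `thermalPairCorr` at positive side, unfolded. Koma–Tasaki, PRL 68 (1992) 3248, eq. (2).
[folklore] -/
@[simp] theorem thermalPairCorr_succ (β t U μ : ℝ) (L : ℕ) (x y : TorusSite d (L + 1)) :
    thermalPairCorr β t U μ (L + 1) x y =
      ((hubbardTorusWith d (L + 1) t U μ).thermalCorr β (onSitePair x)ᴴ (onSitePair y)).re :=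
  rfl

/-- `thermalSpinCorr` at positive side, unfolded. Koma–Tasaki, PRL 68 (1992) 3248, eq. (3).
[folklore] -/
@[simp] theorem thermalSpinCorr_succ (β t U μ : ℝ) (L : ℕ) (x y : TorusSite d (L + 1)) :
    thermalSpinCorr β t U μ (L + 1) x y =
      ((hubbardTorusWith d (L + 1) t U μ).thermalCorr β (siteSpinPlus x) (siteSpinPlus y)ᴴ).re :=
  rfl

/-- **hubbard.S11** (Koma–Tasaki, `d = 2`, superconducting correlations). For the Hubbard model
on the tori `(ℤ/Lℤ)²` with any hopping `t`, any interaction `U`, any chemical potential `μ`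
("any filling") and any inverse temperature `0 < β < ∞`, there are `f = f(β) > 0` and `C` such
that, uniformly in the side `L`,
`|⟨c†_{x↑} c†_{x↓} c_{y↓} c_{y↑}⟩_{β, L}| ≤ C (dist(x, y) + 1)^{-f}` (periodic `ℓ^∞` distance
`torusDist`; Koma–Tasaki give `f(β)` explicitly, decaying like `1/β` for large `β`, and their
bound is in fact uniform in `U` and `μ`). Koma–Tasaki, PRL 68 (1992) 3248, Theorem, eq. (6).
[cite: KomaTasakiPRL1992, Theorem, eq. (6)] -/
def koma_tasaki_2d : Prop :=
  ∀ (t U μ β : ℝ) (hβ : 0 < β),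
    ∃ f : ℝ, 0 < f ∧ ∃ C : ℝ, ∀ (L : ℕ) [NeZero L] (x y : TorusSite 2 L),
      ‖(hubbardTorusWith 2 L t U μ).thermalCorr β (onSitePair x)ᴴ (onSitePair y)‖ ≤
        C * ((torusDist x y : ℝ) + 1) ^ (-f)

/-- **hubbard.S11** (Koma–Tasaki, `d = 1`, superconducting correlations). On the rings `ℤ/Lℤ`,
for any `t, U, μ` and `0 < β`, the thermal pair correlation decays exponentially, uniformly in
`L`: `|⟨c†_{x↑} c†_{x↓} c_{y↓} c_{y↑}⟩_{β, L}| ≤ C e^{-m · dist(x, y)}` with `m = m(β) > 0`.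
Koma–Tasaki, PRL 68 (1992) 3248, Theorem (one-dimensional case).
[cite: KomaTasakiPRL1992, Theorem (d = 1)] -/
def koma_tasaki_1d : Prop :=
  ∀ (t U μ β : ℝ) (hβ : 0 < β),
    ∃ m : ℝ, 0 < m ∧ ∃ C : ℝ, ∀ (L : ℕ) [NeZero L] (x y : TorusSite 1 L),
      ‖(hubbardTorusWith 1 L t U μ).thermalCorr β (onSitePair x)ᴴ (onSitePair y)‖ ≤
        C * Real.exp (-m * (torusDist x y : ℝ))

/-- **hubbard.S11** (Koma–Tasaki, magnetic correlations). The same bounds hold for the transverse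
spin correlation `⟨S⁺_x S⁻_y⟩_{β, L}`: power-law decay `C (dist(x, y) + 1)^{-f(β)}` on `(ℤ/Lℤ)²`
and exponential decay on `ℤ/Lℤ`, for any `t, U, μ` and `0 < β`, uniformly in `L`.
Koma–Tasaki, PRL 68 (1992) 3248, Theorem, eqs. (3), (6).
[cite: KomaTasakiPRL1992, Theorem, eqs. (3) and (6)] -/
def koma_tasaki_magnetic : Prop :=
  ∀ (t U μ β : ℝ) (hβ : 0 < β),
    (∃ f : ℝ, 0 < f ∧ ∃ C : ℝ, ∀ (L : ℕ) [NeZero L] (x y : TorusSite 2 L),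
      ‖(hubbardTorusWith 2 L t U μ).thermalCorr β (siteSpinPlus x) (siteSpinPlus y)ᴴ‖ ≤
        C * ((torusDist x y : ℝ) + 1) ^ (-f)) ∧
    (∃ m : ℝ, 0 < m ∧ ∃ C : ℝ, ∀ (L : ℕ) [NeZero L] (x y : TorusSite 1 L),
      ‖(hubbardTorusWith 1 L t U μ).thermalCorr β (siteSpinPlus x) (siteSpinPlus y)ᴴ‖ ≤
        C * Real.exp (-m * (torusDist x y : ℝ)))

/-- **hubbard.S11** (corollary: no superconducting or magnetic long-range order at `T > 0` in
`d = 2`). For any `t, U, μ` and `0 < β < ∞`, the thermal pair and transverse-spin two-point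
functions of the two-dimensional Hubbard model have no long-range order in the sense of the
outline-§0 convention: `¬ (0 < liminf_L L⁻⁴ Σ_{x, y ∈ (ℤ/Lℤ)²} G_L(x, y))`
(`QLattice.HasTorusLRO`), since `Σ_y (dist(x,y)+1)^{-f} = o(L²)`.
Koma–Tasaki, PRL 68 (1992) 3248, Corollary. [cite: KomaTasakiPRL1992, Corollary] -/
def koma_tasaki_noLRO : Prop :=
  ∀ (t U μ β : ℝ) (hβ : 0 < β),
    ¬ HasTorusLRO (thermalPairCorr (d := 2) β t U μ) ∧
      ¬ HasTorusLRO (thermalSpinCorr (d := 2) β t U μ)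

end KomaTasaki

end Literature.MathematicalPhysics.QuantumLattice
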